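import Summits.QuantumFields.BalabanUV.Beta.FP.KernelWardBounded
import Summits.QuantumFields.BalabanUV.Beta.FP.PerfectPolarization
import Summits.QuantumFields.BalabanUV.Beta.FP.ExpLocalisedBubblePker

/-!
# `BalabanUV.Beta.FP.PerfectPolarizationWard` — road «FP» for binder row D1, sub-row **H2-ASM-5a** (symmetry letters of `PiBF`), module W2 (Ward half, layer a):
# `WardTransversal (flipK (PiBF wg wgh V W v w))` — THE FIRST-BOND WARD IDENTITY OF THE BF PERFECT POLARIZATION OVER ABSTRACT ADMISSIBLE VERTEX DATA, from the
# bounded-leg Ward identity (`KernelWardBounded`) at blocking `N = 1` in both sectors, under the DISPLAYED jet-level covariance letters (W1)∕(W2) of each sector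

HONEST DEPENDENCY (page 1, mandatory): continuum YM on T⁴ ⇐ BetaPertH ∧ nine spine estimates (0/9 proved); BetaPertH ⇐ (D1) ∧ (D4) ∧ CAP+tail;
G-an2-4 gates asym, D1 and NE2/3/4.  HONEST FRAMING (cell contract, verbatim): «discharging `BetaPertH` makes Bałaban's UV stability UNCONDITIONAL —
a real constructive-QFT result; it is NOT the continuum limit and NOT the Clay problem.»  THIS MODULE DISCHARGES NOTHING of the wall: it instantiates W1
(`KernelWardBounded.wardTransversal_flip_hessKer_bdd`) at the two legs of H2V-0's `PiBF` (`Pker`, bounded: `ExpLocalisedBubblePker.abs_Pker_le` = H2-ASM-2's (L0); `G0ker`, bounded by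
`TwoPowerLegs.free.bdd`) and combines the two sectors linearly; the analytic inputs — localisation and translation covariance of the vertex data, the generators
`X`, `Xg` and the jet-level covariance laws (W1)∕(W2) of each sector — are HYPOTHESES displayed in the signature; 0 def, 0 `def … : Prop`, nothing cited, 0 sorry;
0∕4 row-D1 binders; NOT (W1) from (a4) + (P-INV) (layer b, next), NOT (K0) itself (needs `MomentSummable` from (K6), H2-ASM-5), NOT (Kev), NOT hgerm, NOT D1,
NOT BetaPertH, NOT continuum, NOT Clay.

ABSOLUTE RULE (cell charter, verbatim): «No internally-minted statement may enter as a cited fact. Every hypothesis is either kernel-proved in this package or a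
verbatim quotation of a PUBLISHED theorem with page reference. The manuscript(s) under audit are NOT citable for their own disputed steps — they are the thing
under adjudication; programme-internal (2001/route/tribunal) claims are never citable.»

CONTENT ([folklore]∕[our object]):
* §1 `bdd_Pker : Bdd Pker A0P` (`ExpLocalisedBubblePker.abs_Pker_le` BY NAME), `bdd_G0ker : Bdd G0ker free.U`, `blockCovariant_one` (block covariance at `N = 1` from
  leg translation invariance + (a2)-type covariance of the vertex data), `wardTransversal_lincomb` (the predicate is linear).
* §2 **`wardTransversal_flip_hessKer_Pker`** ∕ **`wardTransversal_flip_hessKer_G0ker`**: each sector's `z ↦ hessKer leg V W μ ν (−z)` is `WardTransversal` under: vertex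
  data localised at the unit-lattice bonds (`BiLoc (V μ y) y y Cv δ`, `BiLoc (W μ y ν y′) y y′ Cw δ`), translation covariant, a generator `X y` bi-localised at `y`, and
  (W1) `(leg ∘ divV V y) ∘ leg = leg ∘ X y − X y ∘ leg`, (W2) `divW W y ν y′ = X y ∘ V ν y′ − V ν y′ ∘ X y`.
* §3 **`wardTransversal_flip_PiBF`**: `WardTransversal (fun μ ν z => PiBF wg wgh V W v w μ ν (−z))` for every pair of colour weights.
For the road's data the letters are: (W1) ⟸ H2V-DESIGN (a4) `divV V 0 = c·(MF∘Π₀ − Π₀∘MF)` + (P-INV) `Pker∘MF = 1 = MF∘Pker` on the field block (sub-row H2-P-INVKER) with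
`X y = −c·Π_y`; (W2) = the new admissibility letter (a8) (owner l.26457); ghost: (G-INV) `G0ker∘(−Δ) = 1`.  Layer b (`FP/PerfectPolarizationWardLetters`) derives (W1) from them.
Provenance: G-an2-4 formalisation swarm seat b2b-balaban-gan24-formalise-leaf-02 gen 39 (cross-lane on road FP; sub-row H2-ASM-5a WARD HALF, owner GO l.26457), 2026-08-21.
-/

noncomputable section

namespace Summit.QuantumFields.BalabanUV.Beta.FP.PerfectPolarizationWard

open Finset
open scoped BigOperators
open Literature.MathematicalPhysics.QuantumFieldTheory.Balaban1983to89
open Literature.MathematicalPhysics.QuantumFieldTheory.Balaban1983to89.Beta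
open B12Sec2to5 (l1 l1_nonneg)
open B6BondElimination (unitVec)
open PolarizationSign (WardTransversal)
open ExpKernelCalculus (MKer Site BiLoc comp hessKer VertexFamily VertexFamily₂ BlockCovariant shiftK)
open OneStepResolventKernel (Fib)
open KernelWard (Bdd divV divW)
open TwoPowerLegs (free free_g)
open DyadicShell (Pt supNorm)
open Summit.QuantumFields.BalabanUV.Beta.FP.PerfectPolarization (Pker G0ker PiBF PiBF_def Pker_translate G0ker_translate)
open Summit.QuantumFields.BalabanUV.Beta.FP.PerfectPropagatorLegData (A0P)
open Summit.QuantumFields.BalabanUV.Beta.FP.ExpLocalisedBubblePker (abs_Pker_le)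
open Summit.QuantumFields.BalabanUV.Beta.FP.KernelWardBounded (wardTransversal_flip_hessKer_bdd)

/-! ## §1 The two legs are bounded; block covariance at `N = 1`; linearity of the Ward predicate -/

/-- [our object] **THE GLUON LEG IS BOUNDED**: `Bdd Pker A0P` (beta-d1-formalise-leaf-02's `ExpLocalisedBubblePker.abs_Pker_le` BY NAME: H2-ASM-2 (L0) on the field block,
the other blocks vanish). -/
theorem bdd_Pker : Bdd Pker A0P := fun x y a b => abs_Pker_le x y a b

/-- [our object] **THE GHOST LEG IS BOUNDED**: `Bdd G0ker free.U` (`TwoPowerLegs.free.bdd`: the free lattice Green function of `ℤ⁴` is bounded). -/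
theorem bdd_G0ker : Bdd G0ker free.U := by
  intro x y a b
  rw [PerfectPolarization.G0ker_apply, ← free_g 0 0 (y - x)]
  exact free.bdd 0 0 (y - x)

/-- [folklore] block-translation covariance at blocking `N = 1` from translation invariance of the leg and unit-lattice covariance of the vertex data. -/
theorem blockCovariant_one {Φ : Type*} [Fintype Φ] {A : MKer 4 Φ} {V : Fin 4 → Site 4 → MKer 4 Φ} {W : Fin 4 → Site 4 → Fin 4 → Site 4 → MKer 4 Φ}
    (hA : ∀ t : Site 4, shiftK t A = A) (hV : ∀ (μ : Fin 4) (y t : Site 4), V μ (y + t) = shiftK (-t) (V μ y))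
    (hW : ∀ (μ : Fin 4) (y : Site 4) (ν : Fin 4) (y' t : Site 4), W μ (y + t) ν (y' + t) = shiftK (-t) (W μ y ν y')) : BlockCovariant A V W 1 where
  covA t := by simpa using hA (-t)
  covV μ y t := by simpa using hV μ y t
  covW μ y ν y' t := by simpa using hW μ y ν y' t

/-- [folklore] the Ward predicate is linear: a weighted difference of two transversal kernels is transversal. -/
theorem wardTransversal_lincomb {P Q : B12Beta.Kernel 4} (hP : WardTransversal P) (hQ : WardTransversal Q) (a b : ℝ) :
    WardTransversal (fun μ ν z => a * P μ ν z - b * Q μ ν z) := by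
  intro ν z
  have h1 := hP ν z
  have h2 := hQ ν z
  have e : ∀ μ : Fin 4, (a * P μ ν (z - unitVec μ) - b * Q μ ν (z - unitVec μ)) - (a * P μ ν z - b * Q μ ν z)
      = a * (P μ ν (z - unitVec μ) - P μ ν z) - b * (Q μ ν (z - unitVec μ) - Q μ ν z) := fun μ => by ring
  simp only [e, Finset.sum_sub_distrib, ← Finset.mul_sum]
  rw [← Finset.sum_sub_distrib, h1, ← Finset.sum_sub_distrib, h2]
  ring

/-! ## §2 Each sector: the flipped resolvent Hessian of a bounded leg over covariant localised vertex data is Ward-transversal -/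

section Sectors

variable {Φ : Type*} [Fintype Φ] {A : MKer 4 Φ} {V : Fin 4 → Site 4 → MKer 4 Φ} {W : Fin 4 → Site 4 → Fin 4 → Site 4 → MKer 4 Φ}
  {C Cv Cw Cx δ : ℝ}

/-- [folklore] **ONE SECTOR AT `N = 1`**: bounded translation-invariant leg, vertex data bi-localised at the unit-lattice bonds and translation covariant, generator `X y`
bi-localised at `y`, (W1) + (W2) ⟹ `WardTransversal (fun μ ν z => hessKer A V W μ ν (−z))` (`KernelWardBounded.wardTransversal_flip_hessKer_bdd` at `N = 1`). -/
theorem wardTransversal_flip_hessKer_one (X : Site 4 → MKer 4 Φ) (hAb : Bdd A C) (hA : ∀ t : Site 4, shiftK t A = A)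
    (hV : ∀ (μ : Fin 4) (y : Site 4), BiLoc (V μ y) y y Cv δ) (hW : ∀ (μ : Fin 4) (y : Site 4) (ν : Fin 4) (y' : Site 4), BiLoc (W μ y ν y') y y' Cw δ)
    (hcovV : ∀ (μ : Fin 4) (y t : Site 4), V μ (y + t) = shiftK (-t) (V μ y))
    (hcovW : ∀ (μ : Fin 4) (y : Site 4) (ν : Fin 4) (y' t : Site 4), W μ (y + t) ν (y' + t) = shiftK (-t) (W μ y ν y'))
    (hX : ∀ y, BiLoc (X y) y y Cx δ) (hδ : 0 < δ)
    (hW1 : ∀ y, comp (comp A (divV V y)) A = comp A (X y) - comp (X y) A)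
    (hW2 : ∀ y ν y', divW W y ν y' = comp (X y) (V ν y') - comp (V ν y') (X y)) :
    WardTransversal (fun μ ν z => hessKer A V W μ ν (-z)) := by
  have hV' : VertexFamily V 1 Cv δ := fun μ y => by simpa using hV μ y
  have hW' : VertexFamily₂ W 1 Cw δ := fun μ y ν y' => by simpa using hW μ y ν y'
  have hX' : ∀ y, BiLoc (X y) (((1 : ℕ) : ℤ) • y) (((1 : ℕ) : ℤ) • y) Cx δ := fun y => by simpa using hX y
  exact wardTransversal_flip_hessKer_bdd X hAb hV' hW' hX' hδ (blockCovariant_one hA hcovV hcovW) hW1 hW2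

end Sectors

/-! ## §3 The BF perfect polarization over admissible data is Ward-transversal in its first bond -/

/-- [our object] **`WardTransversal (flipK (PiBF wg wgh V W v w))`** — THE WARD LETTER OF H2-ASM-5a: for gluon-sector data `(V, W)` on the packed fibre and ghost-sector data
`(v, w)` on the scalar fibre, each bi-localised at the unit-lattice bonds, translation covariant, with generators `X`, `Xg` and the jet-level covariance laws
(W1)∕(W2) against the legs `Pker` ∕ `G0ker`, the flipped BF perfect polarization `z ↦ PiBF wg wgh V W v w μ ν (−z)` satisfies the printed first-bond divergence law
`PolarizationSign.WardTransversal`, for EVERY pair of colour weights. -/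
theorem wardTransversal_flip_PiBF (wg wgh : ℝ)
    {V : Fin 4 → Site 4 → MKer 4 (Fib 3)} {W : Fin 4 → Site 4 → Fin 4 → Site 4 → MKer 4 (Fib 3)}
    {v : Fin 4 → Site 4 → MKer 4 Unit} {w : Fin 4 → Site 4 → Fin 4 → Site 4 → MKer 4 Unit} {Cv Cw Cx Cv' Cw' Cx' δ : ℝ} (hδ : 0 < δ)
    (hV : ∀ (μ : Fin 4) (y : Site 4), BiLoc (V μ y) y y Cv δ) (hW : ∀ (μ : Fin 4) (y : Site 4) (ν : Fin 4) (y' : Site 4), BiLoc (W μ y ν y') y y' Cw δ)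
    (hcovV : ∀ (μ : Fin 4) (y t : Site 4), V μ (y + t) = shiftK (-t) (V μ y))
    (hcovW : ∀ (μ : Fin 4) (y : Site 4) (ν : Fin 4) (y' t : Site 4), W μ (y + t) ν (y' + t) = shiftK (-t) (W μ y ν y'))
    (X : Site 4 → MKer 4 (Fib 3)) (hX : ∀ y, BiLoc (X y) y y Cx δ)
    (hW1 : ∀ y, comp (comp Pker (divV V y)) Pker = comp Pker (X y) - comp (X y) Pker)
    (hW2 : ∀ y ν y', divW W y ν y' = comp (X y) (V ν y') - comp (V ν y') (X y))
    (hv : ∀ (μ : Fin 4) (y : Site 4), BiLoc (v μ y) y y Cv' δ) (hw : ∀ (μ : Fin 4) (y : Site 4) (ν : Fin 4) (y' : Site 4), BiLoc (w μ y ν y') y y' Cw' δ)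
    (hcovv : ∀ (μ : Fin 4) (y t : Site 4), v μ (y + t) = shiftK (-t) (v μ y))
    (hcovw : ∀ (μ : Fin 4) (y : Site 4) (ν : Fin 4) (y' t : Site 4), w μ (y + t) ν (y' + t) = shiftK (-t) (w μ y ν y'))
    (Xg : Site 4 → MKer 4 Unit) (hXg : ∀ y, BiLoc (Xg y) y y Cx' δ)
    (hW1g : ∀ y, comp (comp G0ker (divV v y)) G0ker = comp G0ker (Xg y) - comp (Xg y) G0ker)
    (hW2g : ∀ y ν y', divW w y ν y' = comp (Xg y) (v ν y') - comp (v ν y') (Xg y)) :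
    WardTransversal (fun μ ν z => PiBF wg wgh V W v w μ ν (-z)) := by
  have h1 := wardTransversal_flip_hessKer_one X bdd_Pker Pker_translate hV hW hcovV hcovW hX hδ hW1 hW2
  have h2 := wardTransversal_flip_hessKer_one Xg bdd_G0ker G0ker_translate hv hw hcovv hcovw hXg hδ hW1g hW2g
  have h := wardTransversal_lincomb h1 h2 wg wgh
  simpa only [PiBF_def] using h

end Summit.QuantumFields.BalabanUV.Beta.FP.PerfectPolarizationWard

end
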